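import Mathlib
import Literature.NumberTheory.Irrationality.BrownZudilin2022.CubicalForm
import Summits.KontsevichZagierPeriods.Zeta5Search.BarnesMellin
import Summits.KontsevichZagierPeriods.Zeta5Search.BarnesCube
import Summits.KontsevichZagierPeriods.Zeta5Search.RhinViolaIntegrable
import HarnessLib

/-!
# ζ(5) search — Brown–Zudilin's `J(p;q)` as ONE Mellin–Barnes integral over a Rhin–Viola triple integral (cell `pub-zeta5`, seat ct-1 g13)

HONEST FRAMING: systematic search; no irrationality claim unless kernel-certified. Nothing in this file is an
irrationality result, a worthiness exponent or a denominator statement. It is STEP 0 of the Bailey-free (Rhin–Viola) route to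
Brown–Zudilin's hypergeometric generators `h, h'` [BrownZudilin2022, Sect. 7] (memo `ct-1/g12/EULERSYM.md` §5): in the
12-parameter integral (10) [BrownZudilin2022, Sect. 3] only the link `1 − y₃(1−y₄y₅)` carrying `p₆+1` is opened by the
Mellin–Barnes integral of a binomial (`BarnesMellin.mellin_barnes`; the paper opens both links to reach (16)), the variables `y₄, y₅`
then integrate to Euler Beta values, and the block `(y₁,y₂,y₃)` with the CLOSED link `1 − y₃(1−y₁y₂)` is a Rhin–Viola triple integral
`T(p₁,q₁,p₂,q₂; p₃+1+t, q₃−p₆−1−t; p₀+1) = ∫_{(0,1)³} x^{p₁}(1−x)^{q₁}y^{p₂}(1−y)^{q₂}z^{p₃+1+t}(1−z)^{q₃−p₆−1−t}(1−(1−xy)z)^{−(p₀+1)}`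
with COMPLEX `z`-exponents (`t = −c₂+iy` the Mellin variable):

  `J(p;q) = (1/2π) ∫_ℝ Γ(p₆+1+t)Γ(−t)/p₆! · B(p₅+1+t, q₅+1) · B(p₄+1+t, q₄+1) · T(…; p₃+1+t, q₃−p₆−1−t; p₀+1) dy`

(`Jintegral_mellin_T`), for integer parameters with `q ≥ 0`, `p₁, p₂ ≥ 0`, `p₆ ≥ 0`, ANY integer `p₀` (the `p₀`-link stays closed), and every
abscissa `c₂` with `max(0, p₆−q₃, p₀+p₆−p₁−q₃, p₀+p₆−p₂−q₃) < c₂ < min(p₄+1, p₅+1, p₆+1, p₃+2)` (= absolute convergence of the opened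
integrand on `(0,1)⁵ × ℝ`; `RhinViolaIntegrable.rv_integrableOn_cpow`). Route: reflection (12), Mellin–Barnes, Fubini, two product slices of
the cube (`RhinViolaIntegrable.integral_cube_cons_mul`), the coordinate reversal of `(0,1)³`. Theorems only (no new definitions).
-/

noncomputable section

namespace Summit.KontsevichZagierPeriods.Zeta5Search.JintegralMellinT

open MeasureTheory Set Filter
open scoped Real
open Literature.NumberTheory.Irrationality.BrownZudilin2022
open Summit.KontsevichZagierPeriods.Zeta5Search.CubicalSubstitution (openCube_eq_pi measurableSet_openCube)
open Summit.KontsevichZagierPeriods.Zeta5Search.BarnesMellin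
open Summit.KontsevichZagierPeriods.Zeta5Search.BarnesCube
open Summit.KontsevichZagierPeriods.Zeta5Search.RhinViolaIntegrable
open Summit.KontsevichZagierPeriods.Zeta5Search.RhinViolaGenerators (mem_cube measurableSet_cube link_pos)
open Literature.Barriers.CriticalPhenomena.LongRangePhi4.Kato (cpow_ofReal_pos)

/-! ### 1. The reversed integrand of (10) with the `p₆`-link opened -/

/-- **Opening the `p₆`-link of the reversed integrand.** On the open cube, with `w = y₂y₀y₁/(1−y₂)` (indices of the REVERSED
integrand (12): `y 0, y 1` are the printed `y₅, y₄`, `y 2` is `y₃`, `y 3, y 4` are `y₂, y₁`), `1 − y₂(1−y₀y₁) = (1−y₂)(1+w)`, so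
`integrandJ (p₆,…,p₀) (q₅,…,q₁) y = R₁(y) · (1+w)^{−(p₆+1)}` with the `p₀`-link `1 − (1−y₄y₃)y₂` kept CLOSED inside `R₁`.
[BrownZudilin2022, Sect. 3 (12); Sect. 5, "observing that `1−y₃(1−y₁y₂) = (1 + y₃/(1−y₃) y₁y₂)(1−y₃)`"] -/
theorem integrandJ_rev_eq_factor (p : Fin 7 → ℤ) (q : Fin 5 → ℤ) {m₆ : ℕ} (hp6 : p 6 = m₆) {y : Fin 5 → ℝ} (hy : y ∈ openCube) :
    integrandJ ![p 6, p 5, p 4, p 3, p 2, p 1, p 0] ![q 4, q 3, q 2, q 1, q 0] y =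
      (y 0 ^ (p 5) * (1 - y 0) ^ (q 4) * y 1 ^ (p 4) * (1 - y 1) ^ (q 3) * y 2 ^ (p 3 + 1) * (1 - y 2) ^ (q 2) *
          y 3 ^ (p 2) * (1 - y 3) ^ (q 1) * y 4 ^ (p 1) * (1 - y 4) ^ (q 0) /
          ((1 - y 2) ^ (m₆ + 1) * (1 - (1 - y 4 * y 3) * y 2) ^ (p 0 + 1))) *
        ((1 + y 2 * (y 0 * y 1) / (1 - y 2)) ^ (m₆ + 1))⁻¹ := by
  have h2' : 0 < 1 - y 2 := by linarith [(hy 2).2]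
  have h0 := (hy 0).1; have h1 := (hy 1).1; have h2 := (hy 2).1; have h3 := (hy 3).1; have h4 := (hy 4).1
  have e1 : 1 - y 2 * (1 - y 0 * y 1) = (1 - y 2) * (1 + y 2 * (y 0 * y 1) / (1 - y 2)) := by
    field_simp; ring
  have e2 : (1 : ℝ) - y 2 * (1 - y 3 * y 4) = 1 - (1 - y 4 * y 3) * y 2 := by ring
  have hA : (1 + y 2 * (y 0 * y 1) / (1 - y 2)) ≠ 0 := by positivity
  have hL : (1 - (1 - y 4 * y 3) * y 2) ^ (p 0 + 1) ≠ 0 := zpow_ne_zero _ (link_pos (hy 4) (hy 3) (hy 2)).ne'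
  unfold integrandJ
  simp only [Matrix.cons_val_zero, Matrix.cons_val_one, Matrix.cons_val]
  rw [e1, e2, hp6, show ((m₆ : ℤ) + 1) = ((m₆ + 1 : ℕ) : ℤ) by push_cast; ring, zpow_natCast, mul_pow]
  field_simp

/-- **Factorisation of the opened integrand.** With `R₁` as in `integrandJ_rev_eq_factor` and `w = y₂y₀y₁/(1−y₂)`, for every complex `t`,
`R₁(y)·w^t = [y₀^{p₅+t}(1−y₀)^{q₅}] · [y₁^{p₄+t}(1−y₁)^{q₄}] · RV(y₄,y₃,y₂)` where `RV` is the complex-exponent Rhin–Viola integrand with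
exponents `(p₁, q₁, p₂, q₂, p₃+1+t, q₃−p₆−1−t, p₀+1)` (principal powers of the positive atoms). -/
theorem rev_factorisation (p : Fin 7 → ℤ) (q : Fin 5 → ℤ) (m₆ : ℕ) (t : ℂ) {y : Fin 5 → ℝ} (hy : y ∈ openCube) :
    (((y 0 ^ (p 5) * (1 - y 0) ^ (q 4) * y 1 ^ (p 4) * (1 - y 1) ^ (q 3) * y 2 ^ (p 3 + 1) * (1 - y 2) ^ (q 2) *
          y 3 ^ (p 2) * (1 - y 3) ^ (q 1) * y 4 ^ (p 1) * (1 - y 4) ^ (q 0) /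
          ((1 - y 2) ^ (m₆ + 1) * (1 - (1 - y 4 * y 3) * y 2) ^ (p 0 + 1)) : ℝ) : ℂ) *
      ((y 2 * (y 0 * y 1) / (1 - y 2) : ℝ) : ℂ) ^ t) =
    ((y 0 : ℂ) ^ ((p 5 : ℂ) + t) * (1 - (y 0 : ℂ)) ^ ((q 4 : ℂ))) *
    (((y 1 : ℂ) ^ ((p 4 : ℂ) + t) * (1 - (y 1 : ℂ)) ^ ((q 3 : ℂ))) *
    (((y 4 : ℝ) : ℂ) ^ ((p 1 : ℂ)) * ((1 - y 4 : ℝ) : ℂ) ^ ((q 0 : ℂ)) * ((y 3 : ℝ) : ℂ) ^ ((p 2 : ℂ)) *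
      ((1 - y 3 : ℝ) : ℂ) ^ ((q 1 : ℂ)) * ((y 2 : ℝ) : ℂ) ^ ((p 3 : ℂ) + 1 + t) *
      ((1 - y 2 : ℝ) : ℂ) ^ ((q 2 : ℂ) - (m₆ : ℂ) - 1 - t) /
      ((1 - (1 - y 4 * y 3) * y 2 : ℝ) : ℂ) ^ ((p 0 : ℂ) + 1))) := by
  have h0 := (hy 0).1; have h1 := (hy 1).1; have h2 := (hy 2).1; have h3 := (hy 3).1; have h4 := (hy 4).1
  have g0 := (hy 0).2; have g1 := (hy 1).2; have g2 := (hy 2).2; have g3 := (hy 3).2; have g4 := (hy 4).2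
  have h0' : 0 < 1 - y 0 := by linarith
  have h1' : 0 < 1 - y 1 := by linarith
  have h2' : 0 < 1 - y 2 := by linarith
  obtain ⟨h3', h4'⟩ : 0 < 1 - y 3 ∧ 0 < 1 - y 4 := ⟨by linarith, by linarith⟩
  have hL : 0 < 1 - (1 - y 4 * y 3) * y 2 := link_pos (hy 4) (hy 3) (hy 2)
  have hw : 0 < y 2 * (y 0 * y 1) / (1 - y 2) := by positivity
  rw [cpow_ofReal_pos hw, Real.log_div (by positivity) h2'.ne', Real.log_mul h2.ne' (by positivity),
    Real.log_mul h0.ne' h1.ne']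
  have eL : (((1 - (1 - y 4 * y 3) * y 2) ^ (p 0 + 1) : ℝ) : ℂ) =
      Complex.exp ((((p 0 : ℤ) : ℂ) + 1) * (Real.log (1 - (1 - y 4 * y 3) * y 2) : ℂ)) := by
    rw [zpow_ofReal_eq_exp hL]; push_cast; ring_nf
  simp only [Complex.ofReal_mul, Complex.ofReal_inv, zpow_ofReal_eq_exp h0, zpow_ofReal_eq_exp h1,
    zpow_ofReal_eq_exp h2, zpow_ofReal_eq_exp h3, zpow_ofReal_eq_exp h4, zpow_ofReal_eq_exp h0',
    zpow_ofReal_eq_exp h1', zpow_ofReal_eq_exp h2', zpow_ofReal_eq_exp h3', zpow_ofReal_eq_exp h4',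
    pow_ofReal_eq_exp h2', eL, cpow_ofReal_pos h0, cpow_ofReal_pos h1, cpow_ofReal_pos h2,
    cpow_ofReal_pos h3, cpow_ofReal_pos h4, cpow_ofReal_pos h2', cpow_ofReal_pos h3', cpow_ofReal_pos h4', cpow_ofReal_pos hL,
    one_sub_cpow_eq_exp g0, one_sub_cpow_eq_exp g1,
    div_eq_mul_inv, mul_inv, ← Complex.exp_neg, ← Complex.exp_add]
  congr 1
  push_cast
  ring

/-! ### 2. The cube integral of the factorised integrand -/

/-- Reversal of `(0,1)³` for integrability. -/
theorem integrableOn_cube3_rev {E : Type*} [NormedAddCommGroup E] (g : (Fin 3 → ℝ) → E)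
    (hg : IntegrableOn g (univ.pi fun _ : Fin 3 => Ioo (0:ℝ) 1)) :
    IntegrableOn (fun x : Fin 3 → ℝ => g ![x 2, x 1, x 0]) (univ.pi fun _ : Fin 3 => Ioo (0:ℝ) 1) := by
  let e : (Fin 3 → ℝ) ≃ᵐ (Fin 3 → ℝ) := MeasurableEquiv.piCongrLeft (fun _ : Fin 3 => ℝ) Fin.revPerm
  have he : ∀ x : Fin 3 → ℝ, (e x : Fin 3 → ℝ) = ![x 2, x 1, x 0] := by
    intro x; ext i
    simp only [e, MeasurableEquiv.coe_piCongrLeft, Equiv.piCongrLeft_apply_eq_cast, cast_eq, Fin.revPerm_symm,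
      Fin.revPerm_apply]
    fin_cases i <;> rfl
  have hmp : MeasurePreserving e volume volume := volume_measurePreserving_piCongrLeft (fun _ : Fin 3 => ℝ) Fin.revPerm
  have hpre : e ⁻¹' (univ.pi fun _ : Fin 3 => Ioo (0:ℝ) 1) = (univ.pi fun _ : Fin 3 => Ioo (0:ℝ) 1) := by
    ext x
    simp only [Set.mem_preimage, he, mem_univ_pi, mem_Ioo]
    constructor
    · intro hx i
      fin_cases i
      · simpa using hx 2
      · simpa using hx 1
      · simpa using hx 0
    · intro hx i
      fin_cases i
      · simpa using hx 2
      · simpa using hx 1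
      · simpa using hx 0
  have key := (hmp.integrableOn_comp_preimage e.measurableEmbedding).mpr hg
  rw [hpre] at key
  simpa only [Function.comp_def, he] using key

/-- The tail map `y ↦ (y₁,…,y₄)` as a vector literal. -/
theorem tail_eq5 (y : Fin 5 → ℝ) : (fun i : Fin 4 => y i.succ) = ![y 1, y 2, y 3, y 4] := by ext i; fin_cases i <;> rfl

/-- The tail map `x ↦ (x₁,x₂,x₃)` as a vector literal. -/
theorem tail_eq4 (x : Fin 4 → ℝ) : (fun i : Fin 3 => x i.succ) = ![x 1, x 2, x 3] := by ext i; fin_cases i <;> rfl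

/-- **The cube integral factorises**: for `Re(p₅+t), Re(p₄+t) > −1` (the two Beta factors), the integral over `(0,1)⁵` of the
factorised integrand of `rev_factorisation` is `B(p₅+1+t,q₅+1)·B(p₄+1+t,q₄+1)·T`, `T` the Rhin–Viola triple integral with
exponents `(p₁,q₁,p₂,q₂,p₃+1+t,q₃−p₆−1−t,p₀+1)` in its standard orientation. -/
theorem integral_cube_split (p : Fin 7 → ℤ) (q : Fin 5 → ℤ) (hq : ∀ j, 0 ≤ q j) (m₆ : ℕ) (t : ℂ)
    (h5 : -1 < (p 5 : ℝ) + t.re) (h4 : -1 < (p 4 : ℝ) + t.re) :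
    ∫ y in openCube,
      ((y 0 : ℂ) ^ ((p 5 : ℂ) + t) * (1 - (y 0 : ℂ)) ^ ((q 4 : ℂ))) *
      (((y 1 : ℂ) ^ ((p 4 : ℂ) + t) * (1 - (y 1 : ℂ)) ^ ((q 3 : ℂ))) *
      (((y 4 : ℝ) : ℂ) ^ ((p 1 : ℂ)) * ((1 - y 4 : ℝ) : ℂ) ^ ((q 0 : ℂ)) * ((y 3 : ℝ) : ℂ) ^ ((p 2 : ℂ)) *
        ((1 - y 3 : ℝ) : ℂ) ^ ((q 1 : ℂ)) * ((y 2 : ℝ) : ℂ) ^ ((p 3 : ℂ) + 1 + t) *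
        ((1 - y 2 : ℝ) : ℂ) ^ ((q 2 : ℂ) - (m₆ : ℂ) - 1 - t) /
        ((1 - (1 - y 4 * y 3) * y 2 : ℝ) : ℂ) ^ ((p 0 : ℂ) + 1))) =
    (Complex.Gamma ((p 5 : ℂ) + 1 + t) * Complex.Gamma ((q 4 : ℂ) + 1) / Complex.Gamma ((p 5 : ℂ) + (q 4 : ℂ) + 2 + t)) *
    ((Complex.Gamma ((p 4 : ℂ) + 1 + t) * Complex.Gamma ((q 3 : ℂ) + 1) / Complex.Gamma ((p 4 : ℂ) + (q 3 : ℂ) + 2 + t)) *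
    ∫ x in (univ.pi fun _ : Fin 3 => Ioo (0:ℝ) 1),
      ((x 0 : ℝ) : ℂ) ^ ((p 1 : ℂ)) * ((1 - x 0 : ℝ) : ℂ) ^ ((q 0 : ℂ)) * ((x 1 : ℝ) : ℂ) ^ ((p 2 : ℂ)) *
        ((1 - x 1 : ℝ) : ℂ) ^ ((q 1 : ℂ)) * ((x 2 : ℝ) : ℂ) ^ ((p 3 : ℂ) + 1 + t) *
        ((1 - x 2 : ℝ) : ℂ) ^ ((q 2 : ℂ) - (m₆ : ℂ) - 1 - t) /
        ((1 - (1 - x 0 * x 1) * x 2 : ℝ) : ℂ) ^ ((p 0 : ℂ) + 1)) := by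
  have hq3 : (0:ℝ) ≤ q 3 := by exact_mod_cast hq 3
  have hq4 : (0:ℝ) ≤ q 4 := by exact_mod_cast hq 4
  set f0 : ℝ → ℂ := fun s => (s : ℂ) ^ ((p 5 : ℂ) + t) * (1 - (s : ℂ)) ^ ((q 4 : ℂ)) with hf0
  set f1 : ℝ → ℂ := fun s => (s : ℂ) ^ ((p 4 : ℂ) + t) * (1 - (s : ℂ)) ^ ((q 3 : ℂ)) with hf1
  set RV : (Fin 3 → ℝ) → ℂ := fun x => ((x 0 : ℝ) : ℂ) ^ ((p 1 : ℂ)) * ((1 - x 0 : ℝ) : ℂ) ^ ((q 0 : ℂ)) *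
      ((x 1 : ℝ) : ℂ) ^ ((p 2 : ℂ)) * ((1 - x 1 : ℝ) : ℂ) ^ ((q 1 : ℂ)) * ((x 2 : ℝ) : ℂ) ^ ((p 3 : ℂ) + 1 + t) *
      ((1 - x 2 : ℝ) : ℂ) ^ ((q 2 : ℂ) - (m₆ : ℂ) - 1 - t) / ((1 - (1 - x 0 * x 1) * x 2 : ℝ) : ℂ) ^ ((p 0 : ℂ) + 1) with hRV
  set G3 : (Fin 3 → ℝ) → ℂ := fun z => RV ![z 2, z 1, z 0] with hG3
  set G4 : (Fin 4 → ℝ) → ℂ := fun x => f1 (x 0) * G3 (fun i => x i.succ) with hG4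
  have hshape : ∀ y : Fin 5 → ℝ,
      ((y 0 : ℂ) ^ ((p 5 : ℂ) + t) * (1 - (y 0 : ℂ)) ^ ((q 4 : ℂ))) *
      (((y 1 : ℂ) ^ ((p 4 : ℂ) + t) * (1 - (y 1 : ℂ)) ^ ((q 3 : ℂ))) *
      (((y 4 : ℝ) : ℂ) ^ ((p 1 : ℂ)) * ((1 - y 4 : ℝ) : ℂ) ^ ((q 0 : ℂ)) * ((y 3 : ℝ) : ℂ) ^ ((p 2 : ℂ)) *
        ((1 - y 3 : ℝ) : ℂ) ^ ((q 1 : ℂ)) * ((y 2 : ℝ) : ℂ) ^ ((p 3 : ℂ) + 1 + t) *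
        ((1 - y 2 : ℝ) : ℂ) ^ ((q 2 : ℂ) - (m₆ : ℂ) - 1 - t) /
        ((1 - (1 - y 4 * y 3) * y 2 : ℝ) : ℂ) ^ ((p 0 : ℂ) + 1))) = f0 (y 0) * G4 (fun i => y i.succ) := by
    intro y
    simp only [hf0, hG4, hG3, hRV, hf1, tail_eq5, tail_eq4, Matrix.cons_val_zero, Matrix.cons_val_one, Matrix.cons_val]
  simp_rw [hshape]
  rw [openCube_eq_pi, integral_cube_cons_mul 4 f0 G4]
  have hG4i : ∫ x in (univ.pi fun _ : Fin 4 => Ioo (0:ℝ) 1), G4 x =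
      (∫ s in Ioo (0:ℝ) 1, f1 s) * ∫ z in (univ.pi fun _ : Fin 3 => Ioo (0:ℝ) 1), G3 z := integral_cube_cons_mul 3 f1 G3
  rw [hG4i, hG3, setIntegral_cube3_rev RV, hf0, hf1,
    integral_beta_Ioo' (by simp; linarith) (by simp; linarith), integral_beta_Ioo' (by simp; linarith) (by simp; linarith)]
  rw [show (p 5 : ℂ) + t + 1 = (p 5 : ℂ) + 1 + t by ring, show (p 4 : ℂ) + t + 1 = (p 4 : ℂ) + 1 + t by ring,
    show (p 5 : ℂ) + t + (q 4 : ℂ) + 2 = (p 5 : ℂ) + (q 4 : ℂ) + 2 + t by ring,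
    show (p 4 : ℂ) + t + (q 3 : ℂ) + 2 = (p 4 : ℂ) + (q 3 : ℂ) + 2 + t by ring]

/-- Integrability companion of `integral_cube_split`: the factorised integrand is integrable on `(0,1)⁵` as soon as the two
Beta integrands are (`Re(p₅+t), Re(p₄+t) > −1`) and the Rhin–Viola integrand is (`RhinViolaIntegrable.rv_integrableOn_cpow`). -/
theorem integrableOn_cube_split (p : Fin 7 → ℤ) (q : Fin 5 → ℤ) (hq : ∀ j, 0 ≤ q j) (m₆ : ℕ) (t : ℂ)
    (hp1 : 0 ≤ p 1) (hp2 : 0 ≤ p 2) (h5 : -1 < (p 5 : ℝ) + t.re) (h4 : -1 < (p 4 : ℝ) + t.re)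
    (h3 : -1 < (p 3 : ℝ) + 1 + t.re) (hQ : -1 < (q 2 : ℝ) - m₆ - 1 - t.re)
    (hcA : (p 0 : ℝ) + 1 < p 1 + ((q 2 : ℝ) - m₆ - 1 - t.re) + 2) (hcB : (p 0 : ℝ) + 1 < p 2 + ((q 2 : ℝ) - m₆ - 1 - t.re) + 2) :
    IntegrableOn (fun y : Fin 5 → ℝ =>
      ((y 0 : ℂ) ^ ((p 5 : ℂ) + t) * (1 - (y 0 : ℂ)) ^ ((q 4 : ℂ))) *
      (((y 1 : ℂ) ^ ((p 4 : ℂ) + t) * (1 - (y 1 : ℂ)) ^ ((q 3 : ℂ))) *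
      (((y 4 : ℝ) : ℂ) ^ ((p 1 : ℂ)) * ((1 - y 4 : ℝ) : ℂ) ^ ((q 0 : ℂ)) * ((y 3 : ℝ) : ℂ) ^ ((p 2 : ℂ)) *
        ((1 - y 3 : ℝ) : ℂ) ^ ((q 1 : ℂ)) * ((y 2 : ℝ) : ℂ) ^ ((p 3 : ℂ) + 1 + t) *
        ((1 - y 2 : ℝ) : ℂ) ^ ((q 2 : ℂ) - (m₆ : ℂ) - 1 - t) /
        ((1 - (1 - y 4 * y 3) * y 2 : ℝ) : ℂ) ^ ((p 0 : ℂ) + 1)))) openCube := by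
  have hq0 : (0:ℝ) ≤ q 0 := by exact_mod_cast hq 0
  have hq1 : (0:ℝ) ≤ q 1 := by exact_mod_cast hq 1
  have hq3 : (0:ℝ) ≤ q 3 := by exact_mod_cast hq 3
  have hq4 : (0:ℝ) ≤ q 4 := by exact_mod_cast hq 4
  have hp1' : (0:ℝ) ≤ p 1 := by exact_mod_cast hp1
  have hp2' : (0:ℝ) ≤ p 2 := by exact_mod_cast hp2
  set f0 : ℝ → ℂ := fun s => (s : ℂ) ^ ((p 5 : ℂ) + t) * (1 - (s : ℂ)) ^ ((q 4 : ℂ)) with hf0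
  set f1 : ℝ → ℂ := fun s => (s : ℂ) ^ ((p 4 : ℂ) + t) * (1 - (s : ℂ)) ^ ((q 3 : ℂ)) with hf1
  set RV : (Fin 3 → ℝ) → ℂ := fun x => ((x 0 : ℝ) : ℂ) ^ ((p 1 : ℂ)) * ((1 - x 0 : ℝ) : ℂ) ^ ((q 0 : ℂ)) *
      ((x 1 : ℝ) : ℂ) ^ ((p 2 : ℂ)) * ((1 - x 1 : ℝ) : ℂ) ^ ((q 1 : ℂ)) * ((x 2 : ℝ) : ℂ) ^ ((p 3 : ℂ) + 1 + t) *
      ((1 - x 2 : ℝ) : ℂ) ^ ((q 2 : ℂ) - (m₆ : ℂ) - 1 - t) / ((1 - (1 - x 0 * x 1) * x 2 : ℝ) : ℂ) ^ ((p 0 : ℂ) + 1) with hRV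
  set G3 : (Fin 3 → ℝ) → ℂ := fun z => RV ![z 2, z 1, z 0] with hG3
  set G4 : (Fin 4 → ℝ) → ℂ := fun x => f1 (x 0) * G3 (fun i => x i.succ) with hG4
  have hshape : (fun y : Fin 5 → ℝ =>
      ((y 0 : ℂ) ^ ((p 5 : ℂ) + t) * (1 - (y 0 : ℂ)) ^ ((q 4 : ℂ))) *
      (((y 1 : ℂ) ^ ((p 4 : ℂ) + t) * (1 - (y 1 : ℂ)) ^ ((q 3 : ℂ))) *
      (((y 4 : ℝ) : ℂ) ^ ((p 1 : ℂ)) * ((1 - y 4 : ℝ) : ℂ) ^ ((q 0 : ℂ)) * ((y 3 : ℝ) : ℂ) ^ ((p 2 : ℂ)) *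
        ((1 - y 3 : ℝ) : ℂ) ^ ((q 1 : ℂ)) * ((y 2 : ℝ) : ℂ) ^ ((p 3 : ℂ) + 1 + t) *
        ((1 - y 2 : ℝ) : ℂ) ^ ((q 2 : ℂ) - (m₆ : ℂ) - 1 - t) /
        ((1 - (1 - y 4 * y 3) * y 2 : ℝ) : ℂ) ^ ((p 0 : ℂ) + 1)))) = fun y => f0 (y 0) * G4 (fun i => y i.succ) := by
    funext y
    simp only [hf0, hG4, hG3, hRV, hf1, tail_eq5, tail_eq4, Matrix.cons_val_zero, Matrix.cons_val_one, Matrix.cons_val]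
  rw [hshape, openCube_eq_pi]
  refine integrableOn_cube_cons_mul 4 (integrableOn_beta_Ioo' (by simp; linarith) (by simp; linarith)) ?_
  refine integrableOn_cube_cons_mul 3 (integrableOn_beta_Ioo' (by simp; linarith) (by simp; linarith)) ?_
  rw [hG3]
  refine integrableOn_cube3_rev RV ?_
  rw [hRV]
  exact rv_integrableOn_cpow _ _ _ _ _ _ _ (by simp; linarith) (by simp; linarith) (by simp; linarith) (by simp; linarith)
    (by simp; linarith) (by simp; linarith) (by simp; linarith) (by simp; linarith)

/-! ### 3. One Mellin–Barnes integral, and the joint integrability on `(0,1)⁵ × ℝ` -/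

/-- Opening ONE denominator: for `R ∈ ℝ`, `w > 0` and `0 < c < m+1`,
`R·(1+w)^{-(m+1)} = (1/2π) ∫_ℝ R · w^t · Γ(m+1+t)Γ(−t)/m! dy`, `t = −c+iy` (`BarnesMellin.mellin_barnes`). -/
theorem mb_single (m : ℕ) {c : ℝ} (hc : 0 < c) (hc' : c < m + 1) (R : ℝ) {w : ℝ} (hw : 0 < w) :
    (((R * ((1 + w) ^ (m + 1))⁻¹ : ℝ)) : ℂ) =
      (1 / (2 * π) : ℂ) * ∫ η : ℝ, (R : ℂ) * (w : ℂ) ^ (-(c : ℂ) + (η : ℂ) * Complex.I) *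
        (Complex.Gamma ((m : ℂ) + 1 + (-(c : ℂ) + (η : ℂ) * Complex.I)) *
          Complex.Gamma (-(-(c : ℂ) + (η : ℂ) * Complex.I)) / (m.factorial : ℂ)) := by
  push_cast
  rw [mellin_barnes m hw hc hc', ← mul_assoc, mul_comm (R : ℂ), mul_assoc, ← integral_const_mul]
  congr 1
  refine integral_congr_ae (Eventually.of_forall fun η => ?_)
  simp only
  ring

/-- **Fubini input.** With `R₁`, `w` as in `integrandJ_rev_eq_factor` and `G(t) = Γ(p₆+1+t)Γ(−t)/p₆!`, the joint integrand
`H(y,η) = R₁(y)·w^t·G(t)`, `t = −c₂+iη`, is integrable on `(0,1)⁵ × ℝ` for every admissible abscissa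
`max(0, p₆−q₃, p₀+p₆−p₁−q₃, p₀+p₆−p₂−q₃) < c₂ < min(p₄+1, p₅+1, p₆+1, p₃+2)`: its norm is the factorised integrand at `η = 0`
(integrable on the cube, `integrableOn_cube_split`) times `‖G‖` (integrable on `ℝ`, exponential decay of `Γ` on vertical lines). -/
theorem integrable_joint_T (p : Fin 7 → ℤ) (q : Fin 5 → ℤ) (hq : ∀ j, 0 ≤ q j) {m₆ : ℕ} (hp1 : 0 ≤ p 1) (hp2 : 0 ≤ p 2)
    {c₂ : ℝ} (hc0 : 0 < c₂) (hc6 : c₂ < (m₆ : ℝ) + 1) (hc4 : c₂ < (p 4 : ℝ) + 1) (hc5 : c₂ < (p 5 : ℝ) + 1)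
    (hc3 : c₂ < (p 3 : ℝ) + 2) (hcq : (m₆ : ℝ) - q 2 < c₂) (hcA : (p 0 : ℝ) - p 1 - q 2 + m₆ < c₂)
    (hcB : (p 0 : ℝ) - p 2 - q 2 + m₆ < c₂) :
    Integrable (Function.uncurry fun (y : Fin 5 → ℝ) (η : ℝ) =>
      (((y 0 ^ (p 5) * (1 - y 0) ^ (q 4) * y 1 ^ (p 4) * (1 - y 1) ^ (q 3) * y 2 ^ (p 3 + 1) * (1 - y 2) ^ (q 2) *
          y 3 ^ (p 2) * (1 - y 3) ^ (q 1) * y 4 ^ (p 1) * (1 - y 4) ^ (q 0) /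
          ((1 - y 2) ^ (m₆ + 1) * (1 - (1 - y 4 * y 3) * y 2) ^ (p 0 + 1)) : ℝ) : ℂ) *
      ((y 2 * (y 0 * y 1) / (1 - y 2) : ℝ) : ℂ) ^ (-(c₂ : ℂ) + (η : ℂ) * Complex.I)) *
      (Complex.Gamma ((m₆ : ℂ) + 1 + (-(c₂ : ℂ) + (η : ℂ) * Complex.I)) *
          Complex.Gamma (-(-(c₂ : ℂ) + (η : ℂ) * Complex.I)) / (m₆.factorial : ℂ)))
      (((volume : Measure (Fin 5 → ℝ)).restrict openCube).prod (volume : Measure ℝ)) := by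
  -- (a) measurability
  have hRm : Measurable fun y : Fin 5 → ℝ =>
      y 0 ^ (p 5) * (1 - y 0) ^ (q 4) * y 1 ^ (p 4) * (1 - y 1) ^ (q 3) * y 2 ^ (p 3 + 1) * (1 - y 2) ^ (q 2) *
          y 3 ^ (p 2) * (1 - y 3) ^ (q 1) * y 4 ^ (p 1) * (1 - y 4) ^ (q 0) /
          ((1 - y 2) ^ (m₆ + 1) * (1 - (1 - y 4 * y 3) * y 2) ^ (p 0 + 1)) := by fun_prop
  have hWm : Measurable fun y : Fin 5 → ℝ => y 2 * (y 0 * y 1) / (1 - y 2) := by fun_prop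
  have hGm : Measurable fun η : ℝ => Complex.Gamma ((m₆ : ℂ) + 1 + (-(c₂ : ℂ) + (η : ℂ) * Complex.I)) *
      Complex.Gamma (-(-(c₂ : ℂ) + (η : ℂ) * Complex.I)) / (m₆.factorial : ℂ) :=
    ((continuous_Gamma_vertical' m₆ hc0 hc6).div_const _).measurable
  have hs : Measurable fun z : (Fin 5 → ℝ) × ℝ => -(c₂ : ℂ) + (z.2 : ℂ) * Complex.I := by fun_prop
  have hmeas : Measurable (Function.uncurry fun (y : Fin 5 → ℝ) (η : ℝ) =>
      (((y 0 ^ (p 5) * (1 - y 0) ^ (q 4) * y 1 ^ (p 4) * (1 - y 1) ^ (q 3) * y 2 ^ (p 3 + 1) * (1 - y 2) ^ (q 2) *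
          y 3 ^ (p 2) * (1 - y 3) ^ (q 1) * y 4 ^ (p 1) * (1 - y 4) ^ (q 0) /
          ((1 - y 2) ^ (m₆ + 1) * (1 - (1 - y 4 * y 3) * y 2) ^ (p 0 + 1)) : ℝ) : ℂ) *
      ((y 2 * (y 0 * y 1) / (1 - y 2) : ℝ) : ℂ) ^ (-(c₂ : ℂ) + (η : ℂ) * Complex.I)) *
      (Complex.Gamma ((m₆ : ℂ) + 1 + (-(c₂ : ℂ) + (η : ℂ) * Complex.I)) *
          Complex.Gamma (-(-(c₂ : ℂ) + (η : ℂ) * Complex.I)) / (m₆.factorial : ℂ))) :=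
    ((Complex.measurable_ofReal.comp (hRm.comp measurable_fst)).mul
      ((Complex.measurable_ofReal.comp (hWm.comp measurable_fst)).pow hs)).mul (hGm.comp measurable_snd)
  -- (b) domination by a product of integrable functions
  have hΦ := (integrableOn_cube_split p q hq m₆ (-(c₂ : ℂ) + ((0:ℝ) : ℂ) * Complex.I) hp1 hp2
    (by simp; linarith) (by simp; linarith) (by simp; linarith) (by simp; linarith) (by simp; linarith)
    (by simp; linarith)).norm
  have hΨ := ((integrable_Gamma_vertical' m₆ hc0 hc6).div_const (m₆.factorial : ℂ)).norm
  refine Integrable.mono' (hΦ.mul_prod hΨ) hmeas.aestronglyMeasurable ?_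
  have hμ : (((volume : Measure (Fin 5 → ℝ)).restrict openCube).prod (volume : Measure ℝ)) =
      ((volume : Measure (Fin 5 → ℝ)).prod (volume : Measure ℝ)).restrict (openCube ×ˢ univ) := by
    rw [← Measure.prod_restrict, Measure.restrict_univ]
  rw [hμ]
  refine ae_restrict_of_forall_mem (measurableSet_openCube.prod MeasurableSet.univ) ?_
  rintro ⟨y, η⟩ ⟨hy, -⟩
  have h0 := (hy 0).1; have h1 := (hy 1).1; have h2 := (hy 2).1
  have h2' : 0 < 1 - y 2 := by linarith [(hy 2).2]
  have hw : 0 < y 2 * (y 0 * y 1) / (1 - y 2) := by positivity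
  simp only [Function.uncurry_apply_pair]
  rw [← rev_factorisation p q m₆ (-(c₂ : ℂ) + ((0:ℝ) : ℂ) * Complex.I) hy]
  simp only [norm_mul, Complex.norm_cpow_eq_rpow_re_of_pos hw]
  simp

/-! ### 4. The theorem -/

/-- The inner (cube) integral of `H(·, η)`: `B(p₅+1+t,q₅+1)·(B(p₄+1+t,q₄+1)·T(t))·G(t)`. -/
theorem inner_integral_T (p : Fin 7 → ℤ) (q : Fin 5 → ℤ) (hq : ∀ j, 0 ≤ q j) (m₆ : ℕ)
    {c₂ : ℝ} (hc4 : c₂ < (p 4 : ℝ) + 1) (hc5 : c₂ < (p 5 : ℝ) + 1) (η : ℝ) :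
    ∫ y in openCube, (((y 0 ^ (p 5) * (1 - y 0) ^ (q 4) * y 1 ^ (p 4) * (1 - y 1) ^ (q 3) * y 2 ^ (p 3 + 1) *
          (1 - y 2) ^ (q 2) * y 3 ^ (p 2) * (1 - y 3) ^ (q 1) * y 4 ^ (p 1) * (1 - y 4) ^ (q 0) /
          ((1 - y 2) ^ (m₆ + 1) * (1 - (1 - y 4 * y 3) * y 2) ^ (p 0 + 1)) : ℝ) : ℂ) *
      ((y 2 * (y 0 * y 1) / (1 - y 2) : ℝ) : ℂ) ^ (-(c₂ : ℂ) + (η : ℂ) * Complex.I)) *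
      (Complex.Gamma ((m₆ : ℂ) + 1 + (-(c₂ : ℂ) + (η : ℂ) * Complex.I)) *
          Complex.Gamma (-(-(c₂ : ℂ) + (η : ℂ) * Complex.I)) / (m₆.factorial : ℂ)) =
    (Complex.Gamma ((p 5 : ℂ) + 1 + (-(c₂ : ℂ) + (η : ℂ) * Complex.I)) * Complex.Gamma ((q 4 : ℂ) + 1) /
        Complex.Gamma ((p 5 : ℂ) + (q 4 : ℂ) + 2 + (-(c₂ : ℂ) + (η : ℂ) * Complex.I))) *
    ((Complex.Gamma ((p 4 : ℂ) + 1 + (-(c₂ : ℂ) + (η : ℂ) * Complex.I)) * Complex.Gamma ((q 3 : ℂ) + 1) /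
        Complex.Gamma ((p 4 : ℂ) + (q 3 : ℂ) + 2 + (-(c₂ : ℂ) + (η : ℂ) * Complex.I))) *
    ∫ x in (univ.pi fun _ : Fin 3 => Ioo (0:ℝ) 1),
      ((x 0 : ℝ) : ℂ) ^ ((p 1 : ℂ)) * ((1 - x 0 : ℝ) : ℂ) ^ ((q 0 : ℂ)) * ((x 1 : ℝ) : ℂ) ^ ((p 2 : ℂ)) *
        ((1 - x 1 : ℝ) : ℂ) ^ ((q 1 : ℂ)) * ((x 2 : ℝ) : ℂ) ^ ((p 3 : ℂ) + 1 + (-(c₂ : ℂ) + (η : ℂ) * Complex.I)) *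
        ((1 - x 2 : ℝ) : ℂ) ^ ((q 2 : ℂ) - (m₆ : ℂ) - 1 - (-(c₂ : ℂ) + (η : ℂ) * Complex.I)) /
        ((1 - (1 - x 0 * x 1) * x 2 : ℝ) : ℂ) ^ ((p 0 : ℂ) + 1)) *
    (Complex.Gamma ((m₆ : ℂ) + 1 + (-(c₂ : ℂ) + (η : ℂ) * Complex.I)) *
        Complex.Gamma (-(-(c₂ : ℂ) + (η : ℂ) * Complex.I)) / (m₆.factorial : ℂ)) := by
  have hpt : ∀ y ∈ openCube, (((y 0 ^ (p 5) * (1 - y 0) ^ (q 4) * y 1 ^ (p 4) * (1 - y 1) ^ (q 3) * y 2 ^ (p 3 + 1) *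
          (1 - y 2) ^ (q 2) * y 3 ^ (p 2) * (1 - y 3) ^ (q 1) * y 4 ^ (p 1) * (1 - y 4) ^ (q 0) /
          ((1 - y 2) ^ (m₆ + 1) * (1 - (1 - y 4 * y 3) * y 2) ^ (p 0 + 1)) : ℝ) : ℂ) *
      ((y 2 * (y 0 * y 1) / (1 - y 2) : ℝ) : ℂ) ^ (-(c₂ : ℂ) + (η : ℂ) * Complex.I)) *
      (Complex.Gamma ((m₆ : ℂ) + 1 + (-(c₂ : ℂ) + (η : ℂ) * Complex.I)) *
          Complex.Gamma (-(-(c₂ : ℂ) + (η : ℂ) * Complex.I)) / (m₆.factorial : ℂ)) =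
      (((y 0 : ℂ) ^ ((p 5 : ℂ) + (-(c₂ : ℂ) + (η : ℂ) * Complex.I)) * (1 - (y 0 : ℂ)) ^ ((q 4 : ℂ))) *
      (((y 1 : ℂ) ^ ((p 4 : ℂ) + (-(c₂ : ℂ) + (η : ℂ) * Complex.I)) * (1 - (y 1 : ℂ)) ^ ((q 3 : ℂ))) *
      (((y 4 : ℝ) : ℂ) ^ ((p 1 : ℂ)) * ((1 - y 4 : ℝ) : ℂ) ^ ((q 0 : ℂ)) * ((y 3 : ℝ) : ℂ) ^ ((p 2 : ℂ)) *
        ((1 - y 3 : ℝ) : ℂ) ^ ((q 1 : ℂ)) * ((y 2 : ℝ) : ℂ) ^ ((p 3 : ℂ) + 1 + (-(c₂ : ℂ) + (η : ℂ) * Complex.I)) *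
        ((1 - y 2 : ℝ) : ℂ) ^ ((q 2 : ℂ) - (m₆ : ℂ) - 1 - (-(c₂ : ℂ) + (η : ℂ) * Complex.I)) /
        ((1 - (1 - y 4 * y 3) * y 2 : ℝ) : ℂ) ^ ((p 0 : ℂ) + 1)))) *
      (Complex.Gamma ((m₆ : ℂ) + 1 + (-(c₂ : ℂ) + (η : ℂ) * Complex.I)) *
          Complex.Gamma (-(-(c₂ : ℂ) + (η : ℂ) * Complex.I)) / (m₆.factorial : ℂ)) := by
    intro y hy
    rw [rev_factorisation p q m₆ _ hy]
  rw [setIntegral_congr_fun measurableSet_openCube hpt, integral_mul_const,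
    integral_cube_split p q hq m₆ _ (by simp; linarith) (by simp; linarith)]

/-- **`J(p;q)` as ONE Mellin–Barnes integral over a Rhin–Viola triple integral** (STEP 0 of the Bailey-free route to
Brown–Zudilin's `h, h'`): for integers `q ≥ 0`, `p₁, p₂ ≥ 0`, `p₆ = m₆ ∈ ℕ`, ANY `p₀ ∈ ℤ`, and
`max(0, p₆−q₃, p₀+p₆−p₁−q₃, p₀+p₆−p₂−q₃) < c₂ < min(p₄+1, p₅+1, p₆+1, p₃+2)`,
`J(p;q) = (1/2π) ∫_ℝ B(p₅+1+t, q₅+1) · (B(p₄+1+t, q₄+1) · T(p₁,q₁,p₂,q₂; p₃+1+t, q₃−p₆−1−t; p₀+1)) · Γ(p₆+1+t)Γ(−t)/p₆! dy`,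
`t = −c₂+iy`, `B(u,v) = Γ(u)Γ(v)/Γ(u+v)`, `T` the Rhin–Viola triple integral over `(0,1)³` with complex `z`-exponents
(principal powers). [BrownZudilin2022, Sect. 3 (10), (12); Sect. 5 ("Barnes integral representation", `₁F₀` case, and
"the Eulerian integral"); RV §2] -/
theorem Jintegral_mellin_T (p : Fin 7 → ℤ) (q : Fin 5 → ℤ) (hq : ∀ j, 0 ≤ q j) {m₆ : ℕ} (hp6 : p 6 = m₆)
    (hp1 : 0 ≤ p 1) (hp2 : 0 ≤ p 2)
    {c₂ : ℝ} (hc0 : 0 < c₂) (hc6 : c₂ < (m₆ : ℝ) + 1) (hc4 : c₂ < (p 4 : ℝ) + 1) (hc5 : c₂ < (p 5 : ℝ) + 1)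
    (hc3 : c₂ < (p 3 : ℝ) + 2) (hcq : (m₆ : ℝ) - q 2 < c₂) (hcA : (p 0 : ℝ) - p 1 - q 2 + m₆ < c₂)
    (hcB : (p 0 : ℝ) - p 2 - q 2 + m₆ < c₂) :
    (Jintegral p q : ℂ) = (1 / (2 * π) : ℂ) * ∫ η : ℝ,
      (Complex.Gamma ((p 5 : ℂ) + 1 + (-(c₂ : ℂ) + (η : ℂ) * Complex.I)) * Complex.Gamma ((q 4 : ℂ) + 1) /
          Complex.Gamma ((p 5 : ℂ) + (q 4 : ℂ) + 2 + (-(c₂ : ℂ) + (η : ℂ) * Complex.I))) *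
      ((Complex.Gamma ((p 4 : ℂ) + 1 + (-(c₂ : ℂ) + (η : ℂ) * Complex.I)) * Complex.Gamma ((q 3 : ℂ) + 1) /
          Complex.Gamma ((p 4 : ℂ) + (q 3 : ℂ) + 2 + (-(c₂ : ℂ) + (η : ℂ) * Complex.I))) *
      ∫ x in (univ.pi fun _ : Fin 3 => Ioo (0:ℝ) 1),
        ((x 0 : ℝ) : ℂ) ^ ((p 1 : ℂ)) * ((1 - x 0 : ℝ) : ℂ) ^ ((q 0 : ℂ)) * ((x 1 : ℝ) : ℂ) ^ ((p 2 : ℂ)) *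
          ((1 - x 1 : ℝ) : ℂ) ^ ((q 1 : ℂ)) * ((x 2 : ℝ) : ℂ) ^ ((p 3 : ℂ) + 1 + (-(c₂ : ℂ) + (η : ℂ) * Complex.I)) *
          ((1 - x 2 : ℝ) : ℂ) ^ ((q 2 : ℂ) - (m₆ : ℂ) - 1 - (-(c₂ : ℂ) + (η : ℂ) * Complex.I)) /
          ((1 - (1 - x 0 * x 1) * x 2 : ℝ) : ℂ) ^ ((p 0 : ℂ) + 1)) *
      (Complex.Gamma ((m₆ : ℂ) + 1 + (-(c₂ : ℂ) + (η : ℂ) * Complex.I)) *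
          Complex.Gamma (-(-(c₂ : ℂ) + (η : ℂ) * Complex.I)) / (m₆.factorial : ℂ)) := by
  have hInt := integrable_joint_T p q hq (m₆ := m₆) hp1 hp2 hc0 hc6 hc4 hc5 hc3 hcq hcA hcB
  have e0 : (Jintegral p q : ℂ) = (Jintegral ![p 6, p 5, p 4, p 3, p 2, p 1, p 0] ![q 4, q 3, q 2, q 1, q 0] : ℂ) := by
    rw [Jintegral_reverse p q]
  have e1 : (Jintegral ![p 6, p 5, p 4, p 3, p 2, p 1, p 0] ![q 4, q 3, q 2, q 1, q 0] : ℂ) =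
      ∫ y in openCube, (integrandJ ![p 6, p 5, p 4, p 3, p 2, p 1, p 0] ![q 4, q 3, q 2, q 1, q 0] y : ℂ) := by
    rw [Jintegral]; exact integral_ofReal.symm
  have step1 : ∀ y ∈ openCube, (integrandJ ![p 6, p 5, p 4, p 3, p 2, p 1, p 0] ![q 4, q 3, q 2, q 1, q 0] y : ℂ) =
      (1 / (2 * π) : ℂ) * ∫ η : ℝ,
      (((y 0 ^ (p 5) * (1 - y 0) ^ (q 4) * y 1 ^ (p 4) * (1 - y 1) ^ (q 3) * y 2 ^ (p 3 + 1) * (1 - y 2) ^ (q 2) *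
          y 3 ^ (p 2) * (1 - y 3) ^ (q 1) * y 4 ^ (p 1) * (1 - y 4) ^ (q 0) /
          ((1 - y 2) ^ (m₆ + 1) * (1 - (1 - y 4 * y 3) * y 2) ^ (p 0 + 1)) : ℝ) : ℂ) *
      ((y 2 * (y 0 * y 1) / (1 - y 2) : ℝ) : ℂ) ^ (-(c₂ : ℂ) + (η : ℂ) * Complex.I)) *
      (Complex.Gamma ((m₆ : ℂ) + 1 + (-(c₂ : ℂ) + (η : ℂ) * Complex.I)) *
          Complex.Gamma (-(-(c₂ : ℂ) + (η : ℂ) * Complex.I)) / (m₆.factorial : ℂ)) := by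
    intro y hy
    have h0 := (hy 0).1; have h1 := (hy 1).1; have h2 := (hy 2).1
    have h2' : 0 < 1 - y 2 := by linarith [(hy 2).2]
    have hw : 0 < y 2 * (y 0 * y 1) / (1 - y 2) := by positivity
    rw [integrandJ_rev_eq_factor p q hp6 hy]
    exact mb_single m₆ hc0 hc6 _ hw
  have e2 := setIntegral_congr_fun (μ := (volume : Measure (Fin 5 → ℝ))) measurableSet_openCube step1
  rw [e0, e1, e2, integral_const_mul, integral_integral_swap hInt]
  congr 1
  refine integral_congr_ae (Eventually.of_forall fun η => ?_)
  exact inner_integral_T p q hq m₆ hc4 hc5 η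

end Summit.KontsevichZagierPeriods.Zeta5Search.JintegralMellinT

end
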